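import Literature.NumberTheory.EllipticCurves.Rank1Residual.Typed.SelmerCardCertificateRankZero
import Literature.NumberTheory.EllipticCurves.Rank1Residual.Typed.X10
import Literature.NumberTheory.EllipticCurves.Rank1Residual.X10Proofs
import Literature.NumberTheory.EllipticCurves.Cha2005.ShaIndexBoundIrreducible
import HarnessLib

/-!
# X10b, rank `0`, `3 ∣ #Ш_an`: the EXACT `3`-part from Cha's Heegner-index bound (upper) and the `3`-descent (lower) — cell `b2b-bsdres`, unit `b2b-bsdres-x10b`

HONEST FRAMING (run/shared/lean/b2b/bsd-rank1-residual/, verbatim): the goal of the cell is to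
DELETE the COMBINATION-SHAPED residual classes for ALL analytic-rank `≤ 1` elliptic curves over `ℚ`
— "full BSD formula for every rank `≤ 1` curve in class C" assembled STRICTLY from published
theorems — so that the rank-`≤ 1` remainder becomes exactly the CONSTRUCTION-SHAPED classes, which
are TYPED (missing-input `Prop`s), NOT attempted. This is not "finishing BSD".

Theorems only (no definition, no new named fact); pure compositions of tree theorems and of the
named facts Gross–Zagier–Kolyvagin (`hGZK`, bsd.S17), Cassels–Tate (`hCT`, bsd.S18) and
**Cha 2005** (`hCha` = `Cha2005.thm52_padicValNat_shaOrder_le`, Miller 2011 Thm. 5.2: the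
Heegner-index bound `ord_p #Ш(E/ℚ) ≤ 2·ord_p [E(K) : ℤ y_K]` for `ρ̄_{E,p}` IRREDUCIBLE, not
necessarily surjective; vendored by unit x9, `Cha2005/ShaIndexBoundIrreducible.lean`).

**What this file records.** The sub-class X10b := X10 ∧ ¬surj(3) (`p = 3` good ordinary, `E[3]`
irreducible, mod-`3` image a Cartan normaliser `3Ns`/`3Nn`) is CONSTRUCTION-SHAPED as a class
(referee G26 / R6.1). Per curve, the unit's two-engine EXACT `3`-descent (HOME/b2b-bsdres-x10b/
X10B-DESC3NS.md) closes every X10b pair with `3 ∤ #Ш_an` (`Typed/X10SelmerCardCertificate.lean`),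
leaving as the class's per-curve core the RESISTANT list: the rank-`0` pairs with `3 ∣ #Ш_an`
(census `N < 5·10⁵`: 22 isogeny classes, all with `ord_3 #Ш_an = 2`; `10082b1` the one below
`2·10⁴`), where the descent PROVES `Ш(E)[3] ≅ (ℤ/3)²` — the LOWER half — and no (surj)/(Im)/(ram)
theorem gives the upper half. The upper half IS in print per curve WITHOUT surjectivity: Cha's
extension of Kolyvagin's theorem (Miller Thm. 5.2: `p ∤ 2Δ(K)`, `p² ∤ N`, `ρ̄_{E,p}` irreducible;
the census lane's row `T-CHA`), once a Heegner field `K` is exhibited whose Heegner point `y_K` has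
`ord_3 [E(K) : ℤ y_K] ≤ 1` — a FINITE CERTIFICATE (Gross–Zagier height of `y_K` from `L(E,1)`,
`L'(E^{d_K},1)` and a point search / generator on the twist; GJPST 2009 §3.5–3.6, where exactly
this combination "index exactly divisible by `3` + `3`-descent" gives `#Ш(681b)[3^∞] = 9`,
Prop. 3.35). With `ord_3 #Ш_an = 2` the two halves meet: `#Ш(E/ℚ)[3^∞] = 9` and `BSD(E,3)`.

This file proves (binders: `hGZK`, `hCT`, `hCha` — all PUBLISHED named facts; per-curve data as
hypotheses: the Heegner field and point, `ord_p` of the index, `#Ш_an`, the descent line):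
* `missingUpperBoundAt_of_cha_of_index_le` — the typed UPPER half `ord_p #Ш ≤ ord_p #Ш_an` from
  Cha's bound and the index certificate `ord_p [E(K) : ℤ y_K] ≤ k` at a pair with `2k ≤ ord_p #Ш_an`
  (any analytic rank `≤ 1`, any odd `p`);
* `bsdp_of_cha_of_casselsTate_of_dvd` — rank `≤ 1`, `ord_p #Ш_an = 2k`, index certificate
  `ord_p [E(K) : ℤ y_K] ≤ k`, lower certificate `p^{2k-1} ∣ #Ш(E/ℚ)` (Cassels–Tate squareness turns
  it into `p^{2k} ∣ #Ш`) ⇒ `BSD(E,p)`; and `padicValNat_shaOrder_eq_of_cha_of_casselsTate_of_dvd` —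
  under the same data `ord_p #Ш(E/ℚ) = 2k` EXACTLY;
* `bsdp_of_cha_of_casselsTate_of_selmerGroup_ne_bot` — rank `0`, `ord_p #Ш_an = 2`, index
  certificate `≤ 1`, and the descent's native line `Sel^(p)(E/ℚ) ≠ 0` ⇒ `BSD(E,p)`;
* `X10.bsdp_three_rankZero_of_cha_of_selmerThree_ne_bot` — the X10 instance in the cell's
  canonical shape (`ClassX10 W 3`, `r_an = 0`; `irr(3)` from the class feeds both Cha's hypothesis
  and `3 ∤ #E(ℚ)_tors`), and `X10.missingInputAt_of_cha_of_selmerThree_ne_bot` — it DISCHARGES the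
  typed missing input `X10.MissingInputAt W` of `Typed/X10.lean` at such a pair.

Per curve; NOT a class theorem (nothing in print gives the index certificate class-wide — under
BSD it exists iff `3 ∤ ∏_q c_q(E)` and some Heegner twist has `3 ∤ #Ш(E^{d_K})`). The lane books
certificates (two engines); the rows with `3 ∣ c_q` for some `q` are NOT of this shape (Jetchev's
sharpening is printed under surjectivity only). Census use: unit x10b gen 2, HOME/b2b-bsdres-x10b/.

References: Miller 2011 Thm. 5.2 and §4 [Miller2011LMS]; Cha 2005 [Cha2005]; GJPST 2009 Thm. 3.5,
§3.5.5, Prop. 3.35 [GrigorovJorzaPatrikisSteinTarnita2009]; Cassels 1962 / Silverman AEC X.4.14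
[SilvermanAEC2009]; cell files REFEREE.md R6.1, X10B-DESC3NS.md §4, §6.2.
-/

noncomputable section

open scoped Classical

open WeierstrassCurve Literature.NumberTheory.EllipticCurves
  Literature.NumberTheory.EllipticCurves.Rank1Residual

namespace Literature.NumberTheory.EllipticCurves.Rank1Residual.Typed

section ClassFree

variable (W : WeierstrassCurve ℚ) [W.IsElliptic] [W.IsGloballyMinimal] (p : ℕ) [Fact p.Prime]
  {N : ℕ} [NeZero N] {K : Type} [Field K] [NumberField K]

/-- **The typed UPPER half from Cha's bound and an index certificate.** For a non-CM `E/ℚ` of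
analytic rank `≤ 1`, a Heegner field `K` (imaginary quadratic, Heegner hypothesis for the level `N`,
`p ∤ d_K`), a Heegner point `y_K = P` of infinite order, an odd prime `p` with `p² ∤ N` and `E[p]`
irreducible: if `ord_p [E(K) : ℤ P] ≤ k` (per-curve certificate) and `#Ш(E/ℚ)_an` is a rational `q`
with `2k ≤ ord_p q`, then `ord_p #Ш(E/ℚ) ≤ ord_p #Ш(E/ℚ)_an` (`MissingUpperBoundAt W p`), by
Cha 2005 / Miller Thm. 5.2 (`hCha`). [cite: Miller2011LMS, Thm. 5.2 (arXiv:1010.2431 p. 11)] -/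
theorem missingUpperBoundAt_of_cha_of_index_le (hCha : Cha2005.thm52_padicValNat_shaOrder_le)
    (hcm : ¬ W.HasCM) (hr : W.analyticRank ≤ 1) (hK : IsImaginaryQuadratic K)
    (hH : SatisfiesHeegnerHypothesis N K) {P : (W.baseChange K).toAffine.Point}
    (hP : IsHeegnerPoint N W K P) (hnt : ¬ IsOfFinAddOrder P) (hp2 : p ≠ 2)
    (hpD : ¬ (p : ℤ) ∣ NumberField.discr K) (hpN : ¬ p ^ 2 ∣ N) (hirr : Irr W p)
    {k : ℕ} (hI : padicValNat p (AddSubgroup.zmultiples P).index ≤ k)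
    {q : ℚ} (hq : shaAn W = (q : ℂ)) (hv : (2 * k : ℤ) ≤ padicValRat p q) :
    MissingUpperBoundAt W p := by
  have hle := hCha W N K hK hH P hP hnt p hcm hp2 hpD hpN hirr hr
  refine ⟨q, hq, le_trans ?_ hv⟩
  have : (padicValNat p W.shaOrder : ℤ) ≤ ((2 * padicValNat p (AddSubgroup.zmultiples P).index :
      ℕ) : ℤ) := by exact_mod_cast hle
  refine this.trans ?_
  push_cast
  have hk : (padicValNat p (AddSubgroup.zmultiples P).index : ℤ) ≤ k := by exact_mod_cast hI
  linarith

/-- **`BSD(E,p)` from Cha's upper bound and a lower certificate**, analytic rank `≤ 1`, odd `p`: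
granted Gross–Zagier–Kolyvagin (`hGZK`: `rank = r_an`, `Ш(E/ℚ)` finite), Cassels–Tate (`hCT`:
`#Ш` is a square) and Cha 2005 (`hCha`), at a pair with `#Ш(E/ℚ)_an = q`, `ord_p q = 2k`, a Heegner
field/point with index certificate `ord_p [E(K) : ℤ y_K] ≤ k`, and the lower certificate
`p^{2k-1} ∣ #Ш(E/ℚ)` (e.g. `Ш(E)[p] ≠ 0` for `k = 1`), Miller's `BSD(E,p)` holds: the two typed
halves `missingLowerBoundAt_of_casselsTate_of_pow_dvd` and
`missingUpperBoundAt_of_cha_of_index_le` meet. All three inputs are PUBLISHED theorems; the two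
certificates are per-curve computations. [cite: Miller2011LMS, Thm. 5.2 and Def. 1.1]
[cite: SilvermanAEC2009, Thm. X.4.14] -/
theorem bsdp_of_cha_of_casselsTate_of_dvd (hGZK : rank_eq_analyticRank_of_analyticRank_le_one)
    (hCT : exists_casselsTate_pairing (K := ℚ)) (hCha : Cha2005.thm52_padicValNat_shaOrder_le)
    (hcm : ¬ W.HasCM) (hr : W.analyticRank ≤ 1) (hK : IsImaginaryQuadratic K)
    (hH : SatisfiesHeegnerHypothesis N K) {P : (W.baseChange K).toAffine.Point}
    (hP : IsHeegnerPoint N W K P) (hnt : ¬ IsOfFinAddOrder P) (hp2 : p ≠ 2)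
    (hpD : ¬ (p : ℤ) ∣ NumberField.discr K) (hpN : ¬ p ^ 2 ∣ N) (hirr : Irr W p)
    {k : ℕ} (hI : padicValNat p (AddSubgroup.zmultiples P).index ≤ k)
    {q : ℚ} (hq : shaAn W = (q : ℂ)) (hv : padicValRat p q = 2 * k)
    (hdvd : p ^ (2 * k - 1) ∣ W.shaOrder) : BSDp W p :=
  bsdp_of_missingPPartAt W p hGZK hr
    (missingPPartAt_of_lower_of_upper W p
      (missingLowerBoundAt_of_casselsTate_of_pow_dvd W p hCT (hGZK W hr).2 hq hv.le hdvd)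
      (missingUpperBoundAt_of_cha_of_index_le W p hCha hcm hr hK hH hP hnt hp2 hpD hpN hirr hI hq
        hv.symm.le))

/-- **The exact `p`-part under the same data: `ord_p #Ш(E/ℚ) = 2k`** (so for `k = 1`:
`#Ш(E/ℚ)[p^∞]` has order exactly `p²`). Lower: Cassels–Tate squareness and `p^{2k-1} ∣ #Ш`;
upper: Cha's bound and the index certificate. [cite: Miller2011LMS, Thm. 5.2]
[cite: SilvermanAEC2009, Thm. X.4.14] -/
theorem padicValNat_shaOrder_eq_of_cha_of_casselsTate_of_dvd
    (hGZK : rank_eq_analyticRank_of_analyticRank_le_one)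
    (hCT : exists_casselsTate_pairing (K := ℚ)) (hCha : Cha2005.thm52_padicValNat_shaOrder_le)
    (hcm : ¬ W.HasCM) (hr : W.analyticRank ≤ 1) (hK : IsImaginaryQuadratic K)
    (hH : SatisfiesHeegnerHypothesis N K) {P : (W.baseChange K).toAffine.Point}
    (hP : IsHeegnerPoint N W K P) (hnt : ¬ IsOfFinAddOrder P) (hp2 : p ≠ 2)
    (hpD : ¬ (p : ℤ) ∣ NumberField.discr K) (hpN : ¬ p ^ 2 ∣ N) (hirr : Irr W p)
    {k : ℕ} (hI : padicValNat p (AddSubgroup.zmultiples P).index ≤ k)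
    (hdvd : p ^ (2 * k - 1) ∣ W.shaOrder) : padicValNat p W.shaOrder = 2 * k := by
  have hfin : W.ShaFinite := (hGZK W hr).2
  have hsq : IsSquare W.shaOrder := isSquare_shaOrder_of_casselsTate hCT W hfin
  have hn : W.shaOrder ≠ 0 := (WeierstrassCurve.shaOrder_pos W hfin).ne'
  have hlow : 2 * k ≤ padicValNat p W.shaOrder :=
    two_mul_le_padicValNat_of_isSquare_of_pow_dvd hsq hn hdvd
  have hup := hCha W N K hK hH P hP hnt p hcm hp2 hpD hpN hirr hr
  omega

/-- **Rank `0`, native descent line.** Granted GZK, Cassels–Tate and Cha 2005: for a non-CM `E/ℚ`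
of analytic rank `0` with `#Ш(E/ℚ)_an = q`, `ord_p q = 2`, `E[p]` irreducible, a Heegner field `K`
(`p ∤ d_K`, `p² ∤ N`) and Heegner point with index certificate `ord_p [E(K) : ℤ y_K] ≤ 1`, and the
`p`-descent line `Sel^(p)(E/ℚ) ≠ 0` (rank `0` by GZK and `p ∤ #E(ℚ)_tors` by irreducibility, so this
IS `Ш(E)[p] ≠ 0`: `exists_sha_torsion_of_selmerGroup_ne_bot`), `BSD(E,p)` holds and
`#Ш(E/ℚ)[p^∞] = p²`. [cite: Miller2011LMS, Thm. 5.2 and Def. 1.1] [cite: SilvermanAEC2009, Thm. X.4.14] -/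
theorem bsdp_of_cha_of_casselsTate_of_selmerGroup_ne_bot
    (hGZK : rank_eq_analyticRank_of_analyticRank_le_one)
    (hCT : exists_casselsTate_pairing (K := ℚ)) (hCha : Cha2005.thm52_padicValNat_shaOrder_le)
    (hcm : ¬ W.HasCM) (hr : W.analyticRank = 0) (hK : IsImaginaryQuadratic K)
    (hH : SatisfiesHeegnerHypothesis N K) {P : (W.baseChange K).toAffine.Point}
    (hP : IsHeegnerPoint N W K P) (hnt : ¬ IsOfFinAddOrder P) (hp2 : p ≠ 2)
    (hpD : ¬ (p : ℤ) ∣ NumberField.discr K) (hpN : ¬ p ^ 2 ∣ N) (hirr : Irr W p)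
    (hI : padicValNat p (AddSubgroup.zmultiples P).index ≤ 1)
    {q : ℚ} (hq : shaAn W = (q : ℂ)) (hv : padicValRat p q = 2)
    (hSel : W.selmerGroup (p : ℤ) ≠ ⊥) : BSDp W p := by
  have hr1 : W.analyticRank ≤ 1 := by rw [hr]; norm_num
  have hrank : W.mordellWeilRank = 0 := by rw [(hGZK W hr1).1, hr]
  have htors : ¬ p ∣ W.torsionOrder := by
    intro hd
    have h0 := padicValNat_torsionOrder_eq_zero_of_irreducible W p hirr
    rw [padicValNat.eq_zero_iff] at h0
    rcases h0 with h | h | h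
    · exact absurd h (Fact.out : p.Prime).one_lt.ne'
    · exact absurd h W.torsionOrder_pos_holds.ne'
    · exact h hd
  have hdvd : p ∣ W.shaOrder :=
    dvd_shaOrder_of_exists_torsion W p
      (exists_sha_torsion_of_selmerGroup_ne_bot W p hSel hrank htors)
  exact bsdp_of_cha_of_casselsTate_of_dvd W p hGZK hCT hCha hcm hr1 hK hH hP hnt hp2 hpD hpN hirr
    (k := 1) hI hq (by rw [hv]; norm_num) (by simpa using hdvd)

end ClassFree

/-! ### Class X10 at `p = 3`, rank `0` (the X10b RESISTANT list) -/

section X10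

variable (W : WeierstrassCurve ℚ) [W.IsElliptic] [W.IsGloballyMinimal]
  {N : ℕ} [NeZero N] {K : Type} [Field K] [NumberField K]

/-- **X10 ∧ `r = 0` ∧ `ord_3 #Ш_an = 2`: `BSD(E,3)` from PUBLISHED theorems plus two finite
certificates**, valid WITHOUT surjectivity of `ρ̄_{E,3}` (so on X10b). For a non-CM globally
minimal `E/ℚ` in class X10 (`p = 3` good ordinary, `E[3]` irreducible) of analytic rank `0` with
`#Ш(E/ℚ)_an = q`, `ord_3 q = 2`: given a Heegner field `K` (imaginary quadratic, Heegner hypothesis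
for the level `N`, `3 ∤ d_K`, `9 ∤ N`) with Heegner point `P = y_K` of infinite order carrying the
index certificate `ord_3 [E(K) : ℤ P] ≤ 1`, and the `3`-descent line `Sel^(3)(E/ℚ) ≠ 0`, Miller's
`BSD(E,3)` holds. Named facts: GZK (`hGZK`), Cassels–Tate (`hCT`), Cha 2005 (`hCha`, Miller
Thm. 5.2 — irreducibility suffices; `irr(3)` is in the class). Census: the X10b RESISTANT list
(rank `0`, `#Ш_an = 9·unit`; `10082b1` below `2·10⁴`; X10B-DESC3NS.md §6.2: `dim Sel₃ = 2` there,
two engines). Per curve; NOT a class theorem; the lane books the certificates.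
[cite: Miller2011LMS, Thm. 5.2 and Def. 1.1] [cite: SilvermanAEC2009, Thm. X.4.14]
[cite: GrigorovJorzaPatrikisSteinTarnita2009, Prop. 3.35 (681b: the same combination)] -/
theorem X10.bsdp_three_rankZero_of_cha_of_selmerThree_ne_bot
    (hGZK : rank_eq_analyticRank_of_analyticRank_le_one)
    (hCT : exists_casselsTate_pairing (K := ℚ)) (hCha : Cha2005.thm52_padicValNat_shaOrder_le)
    (hX : ClassX10 W 3) (hcm : ¬ W.HasCM) (hr : W.analyticRank = 0)
    (hK : IsImaginaryQuadratic K) (hH : SatisfiesHeegnerHypothesis N K)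
    {P : (W.baseChange K).toAffine.Point} (hP : IsHeegnerPoint N W K P) (hnt : ¬ IsOfFinAddOrder P)
    (h3D : ¬ (3 : ℤ) ∣ NumberField.discr K) (h9N : ¬ 3 ^ 2 ∣ N)
    (hI : padicValNat 3 (AddSubgroup.zmultiples P).index ≤ 1)
    {q : ℚ} (hq : shaAn W = (q : ℂ)) (hv : padicValRat 3 q = 2)
    (hSel : W.selmerGroup (3 : ℤ) ≠ ⊥) : BSDp W 3 :=
  bsdp_of_cha_of_casselsTate_of_selmerGroup_ne_bot W 3 hGZK hCT hCha hcm hr hK hH hP hnt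
    (by decide) h3D h9N hX.2.2.1 hI hq hv (by exact_mod_cast hSel)

/-- **The exact `3`-part on such a pair: `ord_3 #Ш(E/ℚ) = 2`**, i.e. `Ш(E/ℚ)[3^∞]` has order `9`
(the descent's `(ℤ/3)²` is all of it). [cite: Miller2011LMS, Thm. 5.2] [cite: SilvermanAEC2009, Thm. X.4.14] -/
theorem X10.padicValNat_shaOrder_eq_two_of_cha_of_selmerThree_ne_bot
    (hGZK : rank_eq_analyticRank_of_analyticRank_le_one)
    (hCT : exists_casselsTate_pairing (K := ℚ)) (hCha : Cha2005.thm52_padicValNat_shaOrder_le)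
    (hX : ClassX10 W 3) (hcm : ¬ W.HasCM) (hr : W.analyticRank = 0)
    (hK : IsImaginaryQuadratic K) (hH : SatisfiesHeegnerHypothesis N K)
    {P : (W.baseChange K).toAffine.Point} (hP : IsHeegnerPoint N W K P) (hnt : ¬ IsOfFinAddOrder P)
    (h3D : ¬ (3 : ℤ) ∣ NumberField.discr K) (h9N : ¬ 3 ^ 2 ∣ N)
    (hI : padicValNat 3 (AddSubgroup.zmultiples P).index ≤ 1)
    (hSel : W.selmerGroup (3 : ℤ) ≠ ⊥) : padicValNat 3 W.shaOrder = 2 := by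
  have hr1 : W.analyticRank ≤ 1 := by rw [hr]; norm_num
  have hrank : W.mordellWeilRank = 0 := by rw [(hGZK W hr1).1, hr]
  have htors : ¬ 3 ∣ W.torsionOrder := by
    intro hd
    have h0 := padicValNat_torsionOrder_eq_zero_of_irreducible W 3 hX.2.2.1
    rw [padicValNat.eq_zero_iff] at h0
    rcases h0 with h | h | h
    · exact absurd h (by norm_num)
    · exact absurd h W.torsionOrder_pos_holds.ne'
    · exact h hd
  have hdvd : 3 ∣ W.shaOrder :=
    dvd_shaOrder_of_exists_torsion W 3
      (exists_sha_torsion_of_selmerGroup_ne_bot W 3 (by exact_mod_cast hSel) hrank htors)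
  simpa using padicValNat_shaOrder_eq_of_cha_of_casselsTate_of_dvd W 3 hGZK hCT hCha hcm hr1 hK
    hH hP hnt (by decide) h3D h9N hX.2.2.1 (k := 1) hI (by simpa using hdvd)

/-- **Discharging the typed missing input of `Typed/X10.lean`** at such a pair: the data above give
`X10.MissingInputAt W` (`¬Surj W 3 → MissingPPartAt W 3`) — on an X10b RESISTANT pair carrying the
index certificate nothing is missing. Per curve; bookkeeping. [cite: Miller2011LMS, Thm. 5.2 and Def. 1.1] -/
theorem X10.missingInputAt_of_cha_of_selmerThree_ne_bot
    (hGZK : rank_eq_analyticRank_of_analyticRank_le_one)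
    (hCT : exists_casselsTate_pairing (K := ℚ)) (hCha : Cha2005.thm52_padicValNat_shaOrder_le)
    (hX : ClassX10 W 3) (hcm : ¬ W.HasCM) (hr : W.analyticRank = 0)
    (hK : IsImaginaryQuadratic K) (hH : SatisfiesHeegnerHypothesis N K)
    {P : (W.baseChange K).toAffine.Point} (hP : IsHeegnerPoint N W K P) (hnt : ¬ IsOfFinAddOrder P)
    (h3D : ¬ (3 : ℤ) ∣ NumberField.discr K) (h9N : ¬ 3 ^ 2 ∣ N)
    (hI : padicValNat 3 (AddSubgroup.zmultiples P).index ≤ 1)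
    {q : ℚ} (hq : shaAn W = (q : ℂ)) (hv : padicValRat 3 q = 2)
    (hSel : W.selmerGroup (3 : ℤ) ≠ ⊥) : X10.MissingInputAt W := fun _ =>
  haveI : Finite W.sha := (hGZK W hX.analyticRank_le_one).2
  missingPPartAt_of_bsdp W 3
    (X10.bsdp_three_rankZero_of_cha_of_selmerThree_ne_bot W hGZK hCT hCha hX hcm hr hK hH hP hnt
      h3D h9N hI hq hv hSel)

end X10

end Literature.NumberTheory.EllipticCurves.Rank1Residual.Typed

end
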